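import Summits.HodgeConjecture.HodgeConjecture.Theorems.HCCMUnconditionalOfGenericFloorV3
import Summits.HodgeConjecture.CorCM.HypDel.M1primeOfFU
import HarnessLib

/-!
# HC_CM modulo the GENERIC FLOOR — edition FLOOR-G v4 (`hc_cm_of_generic_floor_v4`, E-FU currency)

B-plan1 (g9) R15 (3)–(4) (2026-08-29; director g7 s91 (3) / s92: the E-FU edition).  Edition v3 ★ p676194
`hc_cm_of_generic_floor_v3` (`HCCMUnconditionalOfGenericFloorV3.lean`) takes row I-9 #62 M1′
`hM : Literature.AlgebraicGeometry.ModuliOfAbelianVarieties.deligne1971_siegelModuliOnPoints` ([Deligne1971TravauxShimura] 4.16–4.21,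
[MumfordFogartyKirwan1994] Thm. 7.9 + App. 7A: Mumford's moduli scheme is a `ℚ`-model of the Siegel modular variety ON POINTS) as a
hypothesis.  The E-FU edition ★ `Summit.HodgeConjecture.CorCM.HypDel.M1primeOfFU.M1prime_of_F_U` DERIVES M1′ in the tree from the two
textbook facts (F) #63 `lan2013_siegelFineModuliScheme` ([Lan2013PELCompactifications] Thm. 1.4.1.11 / Cor. 7.2.3.10, [MumfordFogartyKirwan1994]
Thm. 7.9: the fine moduli scheme `𝒜_{g,δ,N}` over `ℚ`, `N ≥ 3`) and (U) #64 `siegelModuli_complexUniformisation` ([MumfordFogartyKirwan1994]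
App. 7A, [Deligne1971TravauxShimura] 4.11–4.12, [Milne2005ShimuraVarieties] Thm. 6.11: its complex points are uniformised by `𝔥_g`, piece by
piece, with the marked universal fibres) through the cell's W-layer (W0, W1a, W1b, W3, W4 — all theorems of that file).  This file is the
one-line re-pointing `hM := M1prime_of_F_U hF hU`; v1, v2, v3 and the print-exact floor ★ `hc_cm_of_floor_v10` (FLOOR 6) stay intact in
their own files.

Main results (namespace `Summit.HodgeConjecture.HodgeConjecture.Theorems`):
* `HDel_of_F_U : lan2013_siegelFineModuliScheme → siegelModuli_complexUniformisation → HCCMUnconditional.HDel` (★ `HDel_of_mumford` ∘ `M1prime_of_F_U`);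
* `hc_cm_of_generic_floor_v4` — hypotheses = EXACTLY SEVEN: (F) #63 `hF`, (U) #64 `hU` (GENERIC, unproved), III-2 (a)′ `hdictE`, III-J3a `hJ3a`,
  III-2 (c)′ `hocc`, VI-1 `hFal`, III-9′ `h415` (the last five token-identical to v1 / v2 / v3 / v10) — the GENERIC seven-input floor in
  E-FU currency beside the PRINT-EXACT six-input floor ★ p638725.  Fan A unchanged (item 24835 `HDel` stays OPEN until (F) and (U) are
  themselves theorems over Mathlib).

A STATUS theorem, not a discharge: HC_CM is proved only modulo the 7 printed citations until rung 0 closes.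
-/

set_option autoImplicit false

-- mandated namespace `Summit.HodgeConjecture.HodgeConjecture.Theorems` trips `linter.dupNamespace` (single-problem summit); off as in
-- `HCCMUnconditionalOfFloor.lean` / `HCCMUnconditionalOfGenericFloorV2.lean` / `…V3.lean`.
set_option linter.dupNamespace false

noncomputable section

namespace Summit.HodgeConjecture.HodgeConjecture.Theorems

open scoped TensorProduct Matrix
open NumberField NumberField.InfinitePlace IsDedekindDomain
open HodgeCM.Model HodgeCM.Model.LiuIndex HodgeCM.Model.TowerCarrier
open Summit.HodgeConjecture.CorCM.Model
open Literature.AlgebraicGeometry.Motives (CMType AbelianVariety)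
open Literature.AlgebraicGeometry.HodgeTheory Literature.NumberTheory.Automorphic.PicardCM
open Literature.AlgebraicGeometry.ShimuraVarieties Literature.AlgebraicGeometry.ShimuraVarieties.UnitaryCanonicalModel
open Literature.NumberTheory.ComplexMultiplication
open Literature.NumberTheory.Automorphic
open Literature.NumberTheory.Automorphic.Liu2021 Literature.NumberTheory.Automorphic.Liu2021.AppendixC
open Literature.NumberTheory.Automorphic.Liu2021.Def411WeilCarriers (lineOf locF Rep)
open Summit.HodgeConjecture.CorCM.Transposition.OmegaTransport (realUnit)
open HodgeCM.Model.ArchSideTerm (e₁)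
open Literature.NumberTheory.GelbartRogawski1991 Literature.NumberTheory.GelbartRogawski1991.UnitaryDualPair
open Literature.RepresentationTheory Literature.RepresentationTheory.Liu2021
open Summit.HodgeConjecture.CorCM
open Summit.HodgeConjecture.CorCM.Transposition
open Literature.NumberTheory.GelbartRogawski1991.OscillatorTripleDictionary (OccursInH1 IsIsoToOmega)
open Summit.HodgeConjecture.CorCM.Lines.A3Liu418 (Thm415AtFace EpsRigidAtFace)
open Summit.HodgeConjecture.HodgeConjecture.Theses (HCCMUnconditional.HDel)

/-- **`hDel` FROM THE TWO TEXTBOOK FACTS (F), (U)** (B-plan1 (g9) R15; director g7 s91 (3)): ★ `HDel_of_mumford` ([Milne2005ShimuraVarieties]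
Prop. 14.12 through the Mumford receptacle, s90 (B2)) composed with the E-FU head ★ `M1primeOfFU.M1prime_of_F_U` (M1′ from (F) + (U) through
the W-layer).  [cite: Deligne1971TravauxShimura, 4.16–4.21 pp. 150–152] [cite: MumfordFogartyKirwan1994, Thm. 7.9 and App. 7A]
[cite: Lan2013PELCompactifications, Thm. 1.4.1.11 and Cor. 7.2.3.10] [cite: Milne2005ShimuraVarieties, Thm. 6.11 and Prop. 14.12 p. 125] -/
theorem HDel_of_F_U
    (hF : Literature.AlgebraicGeometry.ModuliOfAbelianVarieties.lan2013_siegelFineModuliScheme)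
    (hU : Literature.AlgebraicGeometry.ModuliOfAbelianVarieties.siegelModuli_complexUniformisation) :
    Summit.HodgeConjecture.HodgeConjecture.Theses.HCCMUnconditional.HDel :=
  HDel_of_mumford (Summit.HodgeConjecture.CorCM.HypDel.M1primeOfFU.M1prime_of_F_U hF hU)


set_option synthInstance.maxHeartbeats 400000 in
set_option maxHeartbeats 8000000 in
/-- **GENERIC FLOOR EDITION v4 (E-FU currency; B-plan1 (g9) R15 (3)–(4), director g7 s91 (3) / s92)**: `hc_cm_of_generic_floor_v3` with its
binder I-9 #62 `hM : deligne1971_siegelModuliOnPoints` discharged by ★ `M1primeOfFU.M1prime_of_F_U hF hU` from the two generic named facts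
(F) #63 `hF : lan2013_siegelFineModuliScheme` ([Lan2013PELCompactifications] 1.4.1.11 / 7.2.3.10; [MumfordFogartyKirwan1994] Thm. 7.9) and
(U) #64 `hU : siegelModuli_complexUniformisation` ([MumfordFogartyKirwan1994] App. 7A; [Deligne1971TravauxShimura] 4.11–4.12;
[Milne2005ShimuraVarieties] Thm. 6.11); one-line body by name, the other five binders token-identical to v1 / v2 / v3.  Hypotheses =
EXACTLY: (F) `hF`, (U) `hU`, III-2 (a)′ `hdictE`, III-J3a `hJ3a`, III-2 (c)′ `hocc`, VI-1 `hFal`, III-9′ `h415` (**7**, generic kind).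
A STATUS theorem: HC_CM is proved only modulo the 7 printed citations until rung 0 closes.
[cite: Lan2013PELCompactifications, Thm. 1.4.1.11 and Cor. 7.2.3.10] [cite: Deligne1971TravauxShimura, 4.11–4.12, 4.16–4.21 pp. 150–152]
[cite: MumfordFogartyKirwan1994, Thm. 7.9 and App. 7A] [cite: Milne2005ShimuraVarieties, Thm. 6.11; Prop. 14.12 p. 125]
[cite: Liu2021, Thm. 4.18; Prop. 4.13 and its proof l. 2145; Rem. 4.14; Thm. 4.15; App. D Lem. D.1] [cite: GelbartRogawski1991, Thm. 5.1.1 (p. 448); p. 446]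
[cite: Li1992, Thm. 2.1] [cite: Rogawski1990, Thm. 13.3.1] [cite: Shimura1998, Thm. 21.4; Thm. 18.6] [cite: Faltings1983, Satz 4] -/
theorem hc_cm_of_generic_floor_v4
    -- `hDel` ⇐ (F) #63 + (U) #64 via ★ `M1primeOfFU.M1prime_of_F_U` (E-FU) and ★ `hc_cm_of_generic_floor_v3` (Mumford currency)
    (hF : Literature.AlgebraicGeometry.ModuliOfAbelianVarieties.lan2013_siegelFineModuliScheme)
    (hU : Literature.AlgebraicGeometry.ModuliOfAbelianVarieties.siegelModuli_complexUniformisation)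
    -- `h21` := the closed constant `Theorems.H21_proof` ([Shimura1998] Thm. 21.4 in Serre–Tate currency ⇐ Thm. 18.6 ★ p631138); NO r₀, NO NOS
    -- `h413` ⇐ rows III-2 (a)′ EXISTENCE, III-J3a, III-2 (c)′ «admissible ⇒ occurs in H¹» at the printed datum (E-III2 R1′, print-exact)
    (hdictE :
      ∀ (hDel : Literature.AlgebraicGeometry.ShimuraVarieties.UnitaryCanonicalModel.canonicalModel_exists_printed)
        (F : HodgeCM.CMField) [IsGalois ℚ F] (h6 : 6 ≤ Module.finrank ℚ F) {ι₁ : F →+* ℂ} (V : HodgeCM.HermSpace3 F ι₁) (a₀ : RealScalar F)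
        (Φ : CMType F) (hΦ : ι₁ ∈ Φ.1) (i : (I V (repAt a₀) (muLiu ι₁ GramClass.rep))),
        oscillatorTriple_dictionaryExistence (((uniformOmegaRep (Summit.HodgeConjecture.CorCM.DelRec.exists_recordSystem_of_printed hDel) ⟨HodgeCM.CMField.K F⟩ ι₁ ⟨HodgeCM.HermSpace3.Hm V, HodgeCM.HermSpace3.isHermitian V, HodgeCM.HermSpace3.signature_ι₁ V, HodgeCM.HermSpace3.posDef_of_ne V⟩ Φ e₁ (frameD V) (frameD_real V) (frameD_ne V) (ιVE V) (2 * imagUnit (HodgeCM.CMField.K F))⁻¹ (fun _ _ => (Rep.update ↥(maximalRealSubfield (HodgeCM.CMField.K F)) (imagUnitSq (HodgeCM.CMField.K F)) (Rep.ofLineOf ↥(maximalRealSubfield (HodgeCM.CMField.K F)) (imagUnitSq (HodgeCM.CMField.K F))) (locF ↥(maximalRealSubfield (HodgeCM.CMField.K F)) (imagUnitSq (HodgeCM.CMField.K F)) (realUnit ⟨HodgeCM.CMField.K F⟩ (repAt a₀ (Sigma.fst i)).1 (repAt a₀ (Sigma.fst i)).2.1 (repAt a₀ (Sigma.fst i)).2.2))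 (realUnit ⟨HodgeCM.CMField.K F⟩ (repAt a₀ (Sigma.fst i)).1 (repAt a₀ (Sigma.fst i)).2.1 (repAt a₀ (Sigma.fst i)).2.2) rfl)))).prop413Data ((liuDictionaryPin exists_isReal_hodgeModel_holds hodgePQ_independent_of_hodgeModel_holds BallQuotient.ballQuotientUniformised_holds (cmAbelianVarietyRealised_of_eigenbasis exists_isReal_hodgeModel_holds hodgePQ_independent_of_hodgeModel_holds cmAbelianVarietyEigenbasisRealised_holds) Literature.NumberTheory.Transcendental.arapura2012_cor_15_4_6_holds V (I V (repAt a₀) (muLiu ι₁ GramClass.rep)) (line V (repAt a₀) (muLiu ι₁ GramClass.rep)))).H))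
    (hJ3a :
      ∀ (hDel : Literature.AlgebraicGeometry.ShimuraVarieties.UnitaryCanonicalModel.canonicalModel_exists_printed)
        (F : HodgeCM.CMField) [IsGalois ℚ F] (h6 : 6 ≤ Module.finrank ℚ F) {ι₁ : F →+* ℂ} (V : HodgeCM.HermSpace3 F ι₁) (a₀ : RealScalar F)
        (Φ : CMType F) (hΦ : ι₁ ∈ Φ.1) (i : (I V (repAt a₀) (muLiu ι₁ GramClass.rep))),
        (((uniformOmegaRep (Summit.HodgeConjecture.CorCM.DelRec.exists_recordSystem_of_printed hDel) ⟨HodgeCM.CMField.K F⟩ ι₁ ⟨HodgeCM.HermSpace3.Hm V, HodgeCM.HermSpace3.isHermitian V, HodgeCM.HermSpace3.signature_ι₁ V, HodgeCM.HermSpace3.posDef_of_ne V⟩ Φ e₁ (frameD V) (frameD_real V) (frameD_ne V) (ιVE V) (2 * imagUnit (HodgeCM.CMField.K F))⁻¹ (fun _ _ => (Rep.update ↥(maximalRealSubfield (HodgeCM.CMField.K F)) (imagUnitSq (HodgeCM.CMField.K F)) (Rep.ofLineOf ↥(maximalRealSubfield (HodgeCM.CMField.K F)) (imagUnitSq (HodgeCM.CMField.K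 F))) (locF ↥(maximalRealSubfield (HodgeCM.CMField.K F)) (imagUnitSq (HodgeCM.CMField.K F)) (realUnit ⟨HodgeCM.CMField.K F⟩ (repAt a₀ (Sigma.fst i)).1 (repAt a₀ (Sigma.fst i)).2.1 (repAt a₀ (Sigma.fst i)).2.2)) (realUnit ⟨HodgeCM.CMField.K F⟩ (repAt a₀ (Sigma.fst i)).1 (repAt a₀ (Sigma.fst i)).2.1 (repAt a₀ (Sigma.fst i)).2.2) rfl)))).prop413Data ((liuDictionaryPin exists_isReal_hodgeModel_holds hodgePQ_independent_of_hodgeModel_holds BallQuotient.ballQuotientUniformised_holds (cmAbelianVarietyRealised_of_eigenbasis exists_isReal_hodgeModel_holds hodgePQ_independent_of_hodgeModel_holds cmAbelianVarietyEigenbasisRealised_holds) Literature.NumberTheory.Transcendental.arapura2012_cor_15_4_6_holds V (I V (repAt a₀) (muLiu ι₁ GramClass.rep)) (line V (repAt a₀) (muLiu ι₁ GramClass.rep)))).H).multiplicity_le_one_printed)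
    (hocc :
      ∀ (hDel : Literature.AlgebraicGeometry.ShimuraVarieties.UnitaryCanonicalModel.canonicalModel_exists_printed)
        (F : HodgeCM.CMField) [IsGalois ℚ F] (h6 : 6 ≤ Module.finrank ℚ F) {ι₁ : F →+* ℂ} (V : HodgeCM.HermSpace3 F ι₁) (a₀ : RealScalar F)
        (Φ : CMType F) (hΦ : ι₁ ∈ Φ.1) (i : (I V (repAt a₀) (muLiu ι₁ GramClass.rep))),
        admissible_occursInH1 (((uniformOmegaRep (Summit.HodgeConjecture.CorCM.DelRec.exists_recordSystem_of_printed hDel) ⟨HodgeCM.CMField.K F⟩ ι₁ ⟨HodgeCM.HermSpace3.Hm V, HodgeCM.HermSpace3.isHermitian V, HodgeCM.HermSpace3.signature_ι₁ V, HodgeCM.HermSpace3.posDef_of_ne V⟩ Φ e₁ (frameD V) (frameD_real V) (frameD_ne V) (ιVE V) (2 * imagUnit (HodgeCM.CMField.K F))⁻¹ (fun _ _ => (Rep.update ↥(maximalRealSubfield (HodgeCM.CMField.K F)) (imagUnitSq (HodgeCM.CMField.K F)) (Rep.ofLineOf ↥(maximalRealSubfield (HodgeCM.CMField.K F)) (imagUnitSq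 (HodgeCM.CMField.K F))) (locF ↥(maximalRealSubfield (HodgeCM.CMField.K F)) (imagUnitSq (HodgeCM.CMField.K F)) (realUnit ⟨HodgeCM.CMField.K F⟩ (repAt a₀ (Sigma.fst i)).1 (repAt a₀ (Sigma.fst i)).2.1 (repAt a₀ (Sigma.fst i)).2.2)) (realUnit ⟨HodgeCM.CMField.K F⟩ (repAt a₀ (Sigma.fst i)).1 (repAt a₀ (Sigma.fst i)).2.1 (repAt a₀ (Sigma.fst i)).2.2) rfl)))).prop413Data ((liuDictionaryPin exists_isReal_hodgeModel_holds hodgePQ_independent_of_hodgeModel_holds BallQuotient.ballQuotientUniformised_holds (cmAbelianVarietyRealised_of_eigenbasis exists_isReal_hodgeModel_holds hodgePQ_independent_of_hodgeModel_holds cmAbelianVarietyEigenbasisRealised_holds) Literature.NumberTheory.Transcendental.arapura2012_cor_15_4_6_holds V (I V (repAt a₀) (muLiu ι₁ GramClass.rep)) (line V (repAt a₀) (muLiu ι₁ GramClass.rep)))).H))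
    -- `hLiu418` ⇐ rows VI-1, III-9′ (III-0 Liu Lem. 2.4 (1) and III-11 by their CLOSED tree terms)
    (hFal : ∀ {K : Type} [Field K] (A B : AbelianVariety K) (ℓ : ℕ) [Fact ℓ.Prime], Literature.AlgebraicGeometry.Motives.faltings_tate_bijective A B ℓ)
    (h415 : Thm415AtFace) :
    Summit.HodgeConjecture.HodgeConjecture.Theses.RankFourFaces.CMAbelianHodge :=
  hc_cm_of_generic_floor_v3 (Summit.HodgeConjecture.CorCM.HypDel.M1primeOfFU.M1prime_of_F_U hF hU) hdictE hJ3a hocc hFal h415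

end Summit.HodgeConjecture.HodgeConjecture.Theorems

end
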